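import Summits.Ventures.HSemireg.ComponentTransfer
import Literature.AlgebraicGeometry.HodgeTheory.BlochSemiregularSpreadGlobal
import Literature.AlgebraicGeometry.HodgeTheory.BlochSemiregularSpreadOfSubscheme
import HarnessLib

/-!
# Venture HSemireg — the transfer chain for an ARBITRARY (possibly reducible) local complete intersection
# representative (Bloch 1972 (7.1)/(7.4) with «the topological cycle class [Z₀]»; reducible seeds such as
# Schoen's Δ ∪ (C × C))

HONEST FRAMING. Companion of `ComponentTransfer.lean` (theory seat 3 of the cell `pub-hsemireg`); THEOREMS ONLY, no new
definition, nothing asserted about any variety, no claim that HC / HC_CM holds. `ComponentTransfer.lean` composes the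
chain for an INTEGRAL Bloch-semiregular lci representative (named fact `BlochSemiregularSpread n p`, class hypothesis
«supported on `Z`»). Bloch's printed theorems (7.1)/(7.4)/(7.5) and Buchweitz–Flenner's Thm. 5.2 allow ANY local
complete intersection `Z₀`, with the class hypothesis «the topological cycle class `[Z₀]`» — rendered in the tree by the
named fact `BlochSemiregularSpreadOfSubscheme n p` (`BlochSemiregularSpreadOfSubscheme.lean`: `x = subschemeClass …`,
`[Z] = Σᵢ ℓ(𝒪_{Z,Zᵢ})·cl(Zᵢ)`, Fulton §1.5, through the tree's real cycle class of a resolution family). This file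
composes the SAME chain from that fact, so that reducible representatives (the cell's STEP-0 class (A): Schoen's
Bloch-semiregular reducible surface `Δ ∪ (C × C) ⊂ J(C)²`; Prong C's `Δ ∪ T`) have a component-form door:

* `SweepsClasses.forall_mem_algebraicClasses_of_isOpen` — the globalisation step on a chart in isolation (Bloch p. 65
  «Since `U ⊂ T`, it follows that `T = S`»): algebraic on a non-empty open of the smooth irreducible chart base ⟹
  algebraic on every fibre (tree theorem `charlesSchnell_algebraicityLocus_iUnion_closed.forall_mem_algebraicClasses_of_isOpen`
  with the tree's PROOF `charlesSchnell_algebraicityLocus_iUnion_closed_holds`) ⟹ algebraic on the swept set.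
* `forall_mem_algebraicClasses_of_sweepsClasses_subscheme` (+ `_of_smul_add`, Remark (7.5) with `a, b ∈ ℤ`, `a ≠ 0`,
  consuming the tree's `BlochSemiregularSpreadOfSubscheme.of_smul_add`) — chart form.
* `hc_on_component_of_semiregular_subscheme` (+ `_of_smul_add`) — component form (`A = C.carrier`).

Inputs BY NAME: `hBS : BlochSemiregularSpreadOfSubscheme n p` (hypothesis); `SweepsClasses g f W A` (hypothesis, the
CDK chart, `ComponentTransfer.lean`); `charlesSchnell_algebraicityLocus_iUnion_closed` (discharged in the tree). NOT
inputs: CM-ness, HC_CM, CM density, MT finiteness (see `ComponentTransfer.lean`, `theory/TH3-*.md` of the cell).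

References: [Bloch1972Semiregularity] Invent. Math. 17 (1972), (7.1), (7.4), (7.5), pp. 64–65; [BuchweitzFlenner2003]
Compositio Math. 137 (2003), Thm. 5.2; [Fulton1998] §1.5, §19.1; [CattaniDeligneKaplan1995JAMS] Thm. 1.1, Cor. 1.2;
[CharlesSchnell2014Notes] Prop. 11.3.11.
-/

noncomputable section

open CategoryTheory AlgebraicGeometry Set
open Literature.AlgebraicGeometry.Motives Literature.AlgebraicGeometry.HodgeTheory

namespace Summit.Ventures.HSemireg

local notation3 (prettyPrint := false) "Res[" f ", " s ", " k ", " A "]" =>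
  complexBetti.map (Literature.AlgebraicGeometry.Motives.fiberι f s) k A

/-! ## Globalisation on a chart -/

section Sweep

variable {𝒴 M : SchemeOver ℂ} {g : 𝒴 ⟶ M} {𝒳 T : SchemeOver ℂ} {f : 𝒳 ⟶ T}

/-- **Globalisation on a chart** (Bloch 1972, proof of (7.4), last paragraph: «`T = {s ∈ S | z_s is algebraic}` is
contained in a countable union of closed subvarieties of `S`. Since `U ⊂ T`, it follows that `T = S`»): if the chart
`f : 𝒳 ⟶ T` is a smooth projective family of relative dimension `n` with `𝒳`, `T` quasi-projective, `T` smooth and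
irreducible, and the global class `W` is algebraic on the fibres over a non-empty open `U ⊆ T(ℂ)`, then `W` is
algebraic on every fibre (the tree's proved algebraicity-locus theorem + Baire), hence every class of a set swept by
`(f, W)` is algebraic. [cite: Bloch1972Semiregularity, proof of Thm. (7.4), p. 65]
[cite: CharlesSchnell2014Notes, Prop. 11.3.11 (proof)] -/
theorem SweepsClasses.forall_mem_algebraicClasses_of_isOpen {n p : ℕ} {W : complexBetti 𝒳 (2 * p)}
    {A : Set (FiberClass g (2 * p))} (h : SweepsClasses g f W A)
    (hf : IsSmoothProjectiveFamily f n) (h𝒳 : IsQuasiProjectiveOver 𝒳) (hT : IsQuasiProjectiveOver T)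
    (hTs : _root_.AlgebraicGeometry.Smooth T.hom) [IrreducibleSpace T.left]
    {U : Set (ComplexPoints T)} (hU : IsOpen U) (hUne : U.Nonempty)
    (hUW : ∀ u ∈ U, Res[f, u, 2 * p, W] ∈ algebraicClasses (fiberOver f u) p) :
    ∀ x ∈ A, x.cls ∈ algebraicClasses (fiberOver g x.pt) p :=
  fun _ hx => h.mem_algebraicClasses
    (charlesSchnell_algebraicityLocus_iUnion_closed_holds.forall_mem_algebraicClasses_of_isOpen f n p h𝒳 hT
      hTs hf W hU hUne hUW) hx

end Sweep

/-! ## Chart form, arbitrary lci -/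

section Chart

variable {𝒴 M : SchemeOver ℂ} {g : 𝒴 ⟶ M} {𝒳 T : SchemeOver ℂ} {f : 𝒳 ⟶ T} {n p : ℕ}

/-- **Transfer along a chart, arbitrary lci representative (Bloch (7.1)/(7.4) with «the topological cycle class
`[Z₀]`»).** As `forall_mem_algebraicClasses_of_sweepsClasses`, but the Bloch-semiregular local complete intersection
`i : Z ↪ 𝒴_{t₀}` of codimension `p` need NOT be integral: the class hypothesis is `x₀.cls = [Z]`, the fundamental
class `subschemeClass` of the subscheme (`Σᵢ ℓ(𝒪_{Z,Zᵢ})·cl(Zᵢ)`, read through any resolution family `ρ` of the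
smooth projective fibre), and the named fact consumed is `BlochSemiregularSpreadOfSubscheme n p`.
[cite: Bloch1972Semiregularity, Thm. (7.1) and Thm. (7.4), pp. 64–65] [cite: BuchweitzFlenner2003, Thm. 5.2]
[cite: Fulton1998, §1.5] -/
theorem forall_mem_algebraicClasses_of_sweepsClasses_subscheme (hBS : BlochSemiregularSpreadOfSubscheme n p)
    (hf : IsSmoothProjectiveFamily f n) (h𝒳 : IsQuasiProjectiveOver 𝒳) (hT : IsQuasiProjectiveOver T)
    (hTs : _root_.AlgebraicGeometry.Smooth T.hom) [IrreducibleSpace T.left]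
    {W : complexBetti 𝒳 (2 * p)}
    (hW : ∀ u : ComplexPoints T, IsRationalClass (Res[f, u, 2 * p, W]) ∧
      IsOfHodgeType n (fiberOver f u) (2 * p) p p (Res[f, u, 2 * p, W]))
    {A : Set (FiberClass g (2 * p))} (hsweep : SweepsClasses g f W A)
    {x₀ : FiberClass g (2 * p)} (hx₀ : x₀ ∈ A)
    (hX₀ : IsSmoothProjective n (fiberOver g x₀.pt)) (d : ℕ) (hdp : d + p = n)
    (ρ : ResolutionFamily (fiberOver g x₀.pt) d)
    {Z : Scheme.{0}} (i : Z ⟶ (fiberOver g x₀.pt).left) [IsLocallyNoetherian Z] (hi : IsClosedImmersion i)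
    (hreg : IsRegularImmersionOfCodim i p) (hcodim : ∀ z ∈ Set.range i.base, (p : ℕ∞) ≤ Order.coheight z)
    (hsr : IsBlochSemiregular i n p) (hmem : subschemeCycle i hi ∈ cyclesOfDim (fiberOver g x₀.pt).left d)
    (hcls : x₀.cls = subschemeClass hX₀ hdp ρ i hi) :
    ∀ x ∈ A, x.cls ∈ algebraicClasses (fiberOver g x.pt) p := by
  obtain ⟨u₀, e₀, he₀⟩ := hsweep x₀ hx₀
  have hWx : complexBetti.map e₀.symm.hom (2 * p) (Res[f, u₀, 2 * p, W]) = x₀.cls := by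
    rw [← he₀, Iso.symm_hom, e₀.complexBetti_map_inv_map_hom]
  obtain ⟨U, hU, hu₀, hUW⟩ := hBS (fiberOver g x₀.pt) Z i x₀.cls 𝒳 T f u₀ e₀.symm W hX₀ d hdp ρ hi hreg
    hcodim hsr hmem hcls hf h𝒳 hT hTs hW hWx
  exact hsweep.forall_mem_algebraicClasses_of_isOpen hf h𝒳 hT hTs hU ⟨u₀, hu₀⟩ hUW

/-- **Transfer along a chart, arbitrary lci representative, Remark (7.5) form** («there exist integers `a, b`,
`a ≠ 0`, such that `a z₀ + b l₀ᵖ` is the class of a subscheme `Z₀ ⊂ X₀` which is semi-regular and a local complete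
intersection»): with `L` a global class of the chart that is fibrewise rational `(p,p)` and fibrewise algebraic,
`a • W|_{𝒳_{u₀}} + b • L|_{𝒳_{u₀}} = [Z]` for a Bloch-semiregular lci `Z ↪ 𝒳_{u₀}` of codimension `p`; consumes the
tree's `BlochSemiregularSpreadOfSubscheme.of_smul_add`. [cite: Bloch1972Semiregularity, Remark (7.5), p. 65]
[cite: BuchweitzFlenner2003, Thm. 5.2] -/
theorem forall_mem_algebraicClasses_of_sweepsClasses_subscheme_of_smul_add
    (hBS : BlochSemiregularSpreadOfSubscheme n p)
    (hf : IsSmoothProjectiveFamily f n) (h𝒳 : IsQuasiProjectiveOver 𝒳) (hT : IsQuasiProjectiveOver T)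
    (hTs : _root_.AlgebraicGeometry.Smooth T.hom) [IrreducibleSpace T.left]
    {W L : complexBetti 𝒳 (2 * p)}
    (hW : ∀ u : ComplexPoints T, IsRationalClass (Res[f, u, 2 * p, W]) ∧
      IsOfHodgeType n (fiberOver f u) (2 * p) p p (Res[f, u, 2 * p, W]))
    (hL : ∀ u : ComplexPoints T, IsRationalClass (Res[f, u, 2 * p, L]) ∧
      IsOfHodgeType n (fiberOver f u) (2 * p) p p (Res[f, u, 2 * p, L]))
    (hLalg : ∀ u : ComplexPoints T, Res[f, u, 2 * p, L] ∈ algebraicClasses (fiberOver f u) p)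
    {A : Set (FiberClass g (2 * p))} (hsweep : SweepsClasses g f W A)
    (u₀ : ComplexPoints T) (a b : ℤ) (ha : a ≠ 0)
    (d : ℕ) (hdp : d + p = n) (ρ : ResolutionFamily (fiberOver f u₀) d)
    {Z : Scheme.{0}} (i : Z ⟶ (fiberOver f u₀).left) [IsLocallyNoetherian Z] (hi : IsClosedImmersion i)
    (hreg : IsRegularImmersionOfCodim i p) (hcodim : ∀ z ∈ Set.range i.base, (p : ℕ∞) ≤ Order.coheight z)
    (hsr : IsBlochSemiregular i n p) (hmem : subschemeCycle i hi ∈ cyclesOfDim (fiberOver f u₀).left d)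
    (hcls : (a : ℂ) • Res[f, u₀, 2 * p, W] + (b : ℂ) • Res[f, u₀, 2 * p, L] =
      subschemeClass (hf.isSmoothProjective u₀) hdp ρ i hi) :
    ∀ x ∈ A, x.cls ∈ algebraicClasses (fiberOver g x.pt) p := by
  have hcls' : (a : ℂ) • complexBetti.map (Iso.refl (fiberOver f u₀)).hom (2 * p) (Res[f, u₀, 2 * p, W]) +
      (b : ℂ) • complexBetti.map (Iso.refl (fiberOver f u₀)).hom (2 * p) (Res[f, u₀, 2 * p, L]) =
      subschemeClass (hf.isSmoothProjective u₀) hdp ρ i hi := by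
    rw [Iso.refl_hom, complexBetti.map_id]; exact hcls
  obtain ⟨U, hU, hu₀, hUW⟩ := hBS.of_smul_add (fiberOver f u₀) Z i f u₀ (Iso.refl _) W L a b ha
    (hf.isSmoothProjective u₀) d hdp ρ hi hreg hcodim hsr hmem hf h𝒳 hT hTs hW hL hLalg hcls'
  exact hsweep.forall_mem_algebraicClasses_of_isOpen hf h𝒳 hT hTs hU ⟨u₀, hu₀⟩ hUW

end Chart

/-! ## Component form, arbitrary lci -/

section Component

variable {𝒴 M : SchemeOver ℂ} {g : 𝒴 ⟶ M} {𝒳 T : SchemeOver ℂ} {f : 𝒳 ⟶ T} {n p : ℕ}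

/-- **The transfer chain for an ARBITRARY (possibly reducible) lci representative** — the component form of
`forall_mem_algebraicClasses_of_sweepsClasses_subscheme`: a Bloch-semiregular local complete intersection
`Z ↪ 𝒴_{t₀}` of codimension `p` whose fundamental class `[Z]` IS `α₀` (Bloch (7.1): «the topological cycle class
`[Z₀]`»; e.g. Schoen's reducible surface `Δ ∪ (C × C)`), at one point `(t₀, α₀)` of the component `C`, under the chart
hypothesis, makes every class of `C` algebraic — granted `BlochSemiregularSpreadOfSubscheme n p`.
[cite: Bloch1972Semiregularity, Thm. (7.1), Thm. (7.4), pp. 64–65] [cite: BuchweitzFlenner2003, Thm. 5.2]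
[cite: CattaniDeligneKaplan1995JAMS, Thm. 1.1 and Cor. 1.2] -/
theorem hc_on_component_of_semiregular_subscheme (hBS : BlochSemiregularSpreadOfSubscheme n p)
    (C : HodgeLocusComponent g n p)
    (hf : IsSmoothProjectiveFamily f n) (h𝒳 : IsQuasiProjectiveOver 𝒳) (hT : IsQuasiProjectiveOver T)
    (hTs : _root_.AlgebraicGeometry.Smooth T.hom) [IrreducibleSpace T.left]
    {W : complexBetti 𝒳 (2 * p)}
    (hW : ∀ u : ComplexPoints T, IsRationalClass (Res[f, u, 2 * p, W]) ∧
      IsOfHodgeType n (fiberOver f u) (2 * p) p p (Res[f, u, 2 * p, W]))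
    (hsweep : SweepsClasses g f W C.carrier)
    {x₀ : FiberClass g (2 * p)} (hx₀ : x₀ ∈ C.carrier)
    (hX₀ : IsSmoothProjective n (fiberOver g x₀.pt)) (d : ℕ) (hdp : d + p = n)
    (ρ : ResolutionFamily (fiberOver g x₀.pt) d)
    {Z : Scheme.{0}} (i : Z ⟶ (fiberOver g x₀.pt).left) [IsLocallyNoetherian Z] (hi : IsClosedImmersion i)
    (hreg : IsRegularImmersionOfCodim i p) (hcodim : ∀ z ∈ Set.range i.base, (p : ℕ∞) ≤ Order.coheight z)
    (hsr : IsBlochSemiregular i n p) (hmem : subschemeCycle i hi ∈ cyclesOfDim (fiberOver g x₀.pt).left d)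
    (hcls : x₀.cls = subschemeClass hX₀ hdp ρ i hi) :
    ∀ x ∈ C.carrier, x.cls ∈ algebraicClasses (fiberOver g x.pt) p :=
  forall_mem_algebraicClasses_of_sweepsClasses_subscheme hBS hf h𝒳 hT hTs hW hsweep hx₀ hX₀ d hdp ρ i hi hreg
    hcodim hsr hmem hcls

/-- **The transfer chain, arbitrary lci representative, Remark (7.5) form** (`a·[W] + b·[L] = [Z]` at a point of the
chart, `a ≠ 0`, `L` fibrewise algebraic — the `q·hⁿ + w` shape for a reducible representative).
[cite: Bloch1972Semiregularity, Remark (7.5), p. 65] [cite: BuchweitzFlenner2003, Thm. 5.2]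
[cite: CattaniDeligneKaplan1995JAMS, Thm. 1.1 and Cor. 1.2] -/
theorem hc_on_component_of_semiregular_subscheme_of_smul_add (hBS : BlochSemiregularSpreadOfSubscheme n p)
    (C : HodgeLocusComponent g n p)
    (hf : IsSmoothProjectiveFamily f n) (h𝒳 : IsQuasiProjectiveOver 𝒳) (hT : IsQuasiProjectiveOver T)
    (hTs : _root_.AlgebraicGeometry.Smooth T.hom) [IrreducibleSpace T.left]
    {W L : complexBetti 𝒳 (2 * p)}
    (hW : ∀ u : ComplexPoints T, IsRationalClass (Res[f, u, 2 * p, W]) ∧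
      IsOfHodgeType n (fiberOver f u) (2 * p) p p (Res[f, u, 2 * p, W]))
    (hL : ∀ u : ComplexPoints T, IsRationalClass (Res[f, u, 2 * p, L]) ∧
      IsOfHodgeType n (fiberOver f u) (2 * p) p p (Res[f, u, 2 * p, L]))
    (hLalg : ∀ u : ComplexPoints T, Res[f, u, 2 * p, L] ∈ algebraicClasses (fiberOver f u) p)
    (hsweep : SweepsClasses g f W C.carrier)
    (u₀ : ComplexPoints T) (a b : ℤ) (ha : a ≠ 0)
    (d : ℕ) (hdp : d + p = n) (ρ : ResolutionFamily (fiberOver f u₀) d)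
    {Z : Scheme.{0}} (i : Z ⟶ (fiberOver f u₀).left) [IsLocallyNoetherian Z] (hi : IsClosedImmersion i)
    (hreg : IsRegularImmersionOfCodim i p) (hcodim : ∀ z ∈ Set.range i.base, (p : ℕ∞) ≤ Order.coheight z)
    (hsr : IsBlochSemiregular i n p) (hmem : subschemeCycle i hi ∈ cyclesOfDim (fiberOver f u₀).left d)
    (hcls : (a : ℂ) • Res[f, u₀, 2 * p, W] + (b : ℂ) • Res[f, u₀, 2 * p, L] =
      subschemeClass (hf.isSmoothProjective u₀) hdp ρ i hi) :
    ∀ x ∈ C.carrier, x.cls ∈ algebraicClasses (fiberOver g x.pt) p :=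
  forall_mem_algebraicClasses_of_sweepsClasses_subscheme_of_smul_add hBS hf h𝒳 hT hTs hW hL hLalg hsweep u₀ a b
    ha d hdp ρ i hi hreg hcodim hsr hmem hcls

end Component

end Summit.Ventures.HSemireg

end
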